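import Summits.HodgeConjecture.CorCM.HypDel.ExtAmbientReceptacleQArchA
import Summits.HodgeConjecture.CorCM.HypDel.ExtAmbientReceptacleLevelForm
import Literature.AlgebraicGeometry.Motives.ComplexPointsTower
import Literature.AlgebraicGeometry.ShimuraVarieties.UnitaryAuxiliaryExtLevelQuotient
import HarnessLib

/-!
# T3 `stub_Squot`, step D5 — the points map `Ψ` of the quotient receptacle: `PointFormulaK` from the descent square and
# `GaloisIntertwines` from rationality of the quotient map ([Deligne1971TravauxShimura] §5 (5.11.1), Cor. 5.7; [Milne2005ShimuraVarieties] §13 p. 117)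

Cell `hodgecm-mathlib`, crux `HDel` (stmt-HodgeConjecture-24835), T3 v4.1 «Q-architecture» (registered workfile
`Cruxes/HDel/Lines/F1ExtHodgeType.lean` 8335372e), stub `stub_Squot : QArch.SQuot` (owner B-p06; KEY
`wake/KEY-hodgecm-mathlib-B-p06-t3-stub-squot.md` §D5).  HELPER toward that stub (`--supports stmt-HodgeConjecture-24835`); theorems only,
0 `def`, 0 named fact, 0 instance, 0 `sorry`.  HC_CM is proved only modulo the 7 printed citations until rung 0 closes; nothing here is a
proof of I-1′ or of `HDel`.

THE SHAPE OF `Ψ` (D5 of the KEY).  Let `R` be a `ℚ`-model of the Siegel tower `Sg` (★ (σ4)-D `SiegelRationalModel`), `KN` a level,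
`E ⊂ ℂ` a subfield and `jA : (R.Nm KN) ⊗_ℚ E ⟶ A` ANY `E`-morphism out of the `E`-form of the model (in D4 it is the finite Hecke
quotient map).  The receptacle's points map is `Ψ := AlgPoints.map φ` for the `ℂ`-morphism
`φ := e_KN⁻¹ ≫ towerIso⁻¹ ≫ jA ⊗_E ℂ : Sg.Mc KN ⟶ (R.Nm KN) ⊗_ℚ ℂ ⟶ ((R.Nm KN) ⊗_ℚ E) ⊗_E ℂ ⟶ A ⊗_E ℂ`
(★ `Motives.towerIso`).  This file proves, for that `Ψ` and with NO hypothesis on `jA`: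
* `pointsOfForm_symm_map_receptacleMap` — the normal form: read through the `E`-structure of `A`, `Ψ P` is `jA` applied to the
  `E`-structure point `towerPointEquiv E (R.Nm KN) (R.ptQ KN P)` (★ `pointsOfForm_towerPointEquiv`, ★ `ptQ_def`, ★ (N1)
  `pointsOfForm_symm_map_baseChange_map`);
* `galoisIntertwines_map_receptacleMap` — `QArch.GaloisIntertwines R KN A Ψ`: `Aut(ℂ/E)` acts on `A(ℂ)` through the `E`-structure
  as on the `ℚ`-structure points `R.ptQ` (★ (T-b) `towerPointEquiv_smul` + ★ `AlgPoints.map_smul`: `jA` is defined over `E`) —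
  [Milne2005ShimuraVarieties] §13 p. 117 «the action of `Aut(Ω/k)` on `V(Ω)`» transported along a `k`-morphism;
* `pointFormulaK_of_comp_eq` — `QArch.PointFormulaK … A ι Ψ` for ANY `ι` out of the level `K × L₀` making the DESCENT SQUARE
  `extLevelMap ≫ ι = ι' ≫ φ` commute with a product-level morphism `ι'` satisfying `QArch.PointFormulaN` (★ Q4
  `extLevelMap_summandPointExt`: the level change is `([x, aK_V], [t]) ↦ ([x, aK], [t])` on points).
So D4's output (the descended closed immersion `ι` with its square) and D5 meet BY NAME in B-p06's closer `stub_Squot_holds`.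
[cite: Deligne1971TravauxShimura, §5 (5.11.1) p. 159 and Cor. 5.7 p. 156] [cite: Milne2005ShimuraVarieties, §13 p. 117; Thm. 13.6 p. 118]
-/

noncomputable section

open Function MulAction Topology NumberField IsDedekindDomain CategoryTheory CategoryTheory.Limits Matrix
  AlgebraicGeometry
open scoped Matrix ComplexOrder
open Literature.AlgebraicGeometry Literature.AlgebraicGeometry.Motives
open Literature.NumberTheory.Automorphic Literature.NumberTheory.Automorphic.UnitaryGroup
open Literature.NumberTheory.Automorphic.Liu2021.AppendixC (C5.OpenCompactSubgroup C5.SmallLevel)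
open Literature.Geometry.ComplexHyperbolic Literature.Geometry.ComplexHyperbolic.BallModel
open Literature.AlgebraicGeometry.ShimuraVarieties Literature.AlgebraicGeometry.ShimuraVarieties.UnitaryCanonicalModel
open Literature.AlgebraicGeometry.ShimuraVarieties.UnitaryCanonicalModel.Aux
open Literature.AlgebraicGeometry.ModuliOfAbelianVarieties
open Summit.HodgeConjecture.CorCM.HypDel.ExtReceptacle (pointsOfForm_symm_map_baseChange_map)

namespace Summit.HodgeConjecture.CorCM.HypDel.ExtReceptacle.QArch

set_option autoImplicit false

section Galois

variable {g : ℕ} {δ : Fin g → ℕ} {Sg : SiegelComplexRecordSystem g δ}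

/-- **Normal form of the receptacle's points map read through the `E`-structure**: for any `E`-morphism `jA` out of the `E`-form
`(R.Nm KN) ⊗_ℚ E` of the Siegel `ℚ`-model, the point `(e⁻¹ ≫ towerIso⁻¹ ≫ jA ⊗_E ℂ)(P)` of `A ⊗_E ℂ`, read in `A(ℂ)` along
`pointsOfForm A`, is `jA` applied to the `E`-structure point over the `ℚ`-structure point `R.ptQ KN P`.
[cite: Milne2005ShimuraVarieties, §13 p. 117] -/
theorem pointsOfForm_symm_map_receptacleMap (R : SiegelRationalModel g δ Sg) (KN : SiegelLevel δ)
    {E : IntermediateField ℚ ℂ} {A : SchemeOver ↥E} (jA : (Motives.baseChange ℚ ↥E).obj (R.Nm.obj KN) ⟶ A)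
    (P : ComplexPoints (Sg.Mc.obj KN)) :
    (pointsOfForm A).symm
        (AlgPoints.map (R.e.inv.app KN ≫ (towerIso E (R.Nm.obj KN)).inv ≫ (Motives.baseChange ↥E ℂ).map jA) P) =
      AlgPoints.map jA (towerPointEquiv E (R.Nm.obj KN) (R.ptQ KN P)) := by
  rw [AlgPoints.map_comp_apply, AlgPoints.map_comp_apply, pointsOfForm_symm_map_baseChange_map]
  congr 1
  apply (pointsOfForm ((Motives.baseChange ℚ ↥E).obj (R.Nm.obj KN))).injective
  rw [Equiv.apply_symm_apply, pointsOfForm_towerPointEquiv, SiegelRationalModel.ptQ_def, Equiv.apply_symm_apply]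
  rfl

/-- **D5, Galois half: `Ψ` INTERTWINES the Galois actions** (`QArch.GaloisIntertwines`).  For any `E`-morphism `jA` out of the
`E`-form of the Siegel `ℚ`-model at level `KN`, the points map `Ψ = AlgPoints.map (e⁻¹ ≫ towerIso⁻¹ ≫ jA ⊗_E ℂ)` carries the action of
`Aut(ℂ/E) ⊂ Aut(ℂ/ℚ)` on the `ℚ`-structure points `R.ptQ` to its action on `A(ℂ)` through the `E`-structure: `jA` is defined over
`E` (★ `AlgPoints.map_smul`) and the `E`-form's points are the `ℚ`-model's points equivariantly (★ (T-b) `towerPointEquiv_smul`).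
[cite: Milne2005ShimuraVarieties, §13 p. 117 (the action of Aut(Ω/k) on V(Ω)); Thm. 13.6 p. 118]
[cite: Deligne1971TravauxShimura, §5 (5.11.1) p. 159] -/
theorem galoisIntertwines_map_receptacleMap (R : SiegelRationalModel g δ Sg) (KN : SiegelLevel δ)
    {E : IntermediateField ℚ ℂ} {A : SchemeOver ↥E} (jA : (Motives.baseChange ℚ ↥E).obj (R.Nm.obj KN) ⟶ A) :
    GaloisIntertwines R KN A
      (AlgPoints.map (R.e.inv.app KN ≫ (towerIso E (R.Nm.obj KN)).inv ≫ (Motives.baseChange ↥E ℂ).map jA)) := by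
  intro σ P P' h
  rw [pointsOfForm_symm_map_receptacleMap, pointsOfForm_symm_map_receptacleMap, h, towerPointEquiv_smul,
    AlgPoints.map_smul]

end Galois

section PointFormula

variable {L : Type} [Field L] [NumberField L] [IsCMField L]
variable {H : Matrix (Fin 3) (Fin 3) L} {τ : L →+* ℂ} {T : GL (Fin 3) ℂ}
  {hT : formCongr (starRingEnd ℂ) T (H.map τ) = BallModel.J}
  {K₀ : C5.OpenCompactSubgroup ↥(finAdelic (↥(maximalRealSubfield L)) L (IsCMField.complexConj L) 3 H)}
variable (M : Type) [Field M] [NumberField M] [IsCMField M] {j : L →+* M} {ξ₀ ξ : M} {g : ℕ} {δ : Fin g → ℕ}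

/-- **D5, point-formula half: `PointFormulaK` from `PointFormulaN` through the DESCENT SQUARE.**  If `ι'` (product level
`K_V × L_V` into the Siegel level `KN`) satisfies the point formula `([x, aK_V], [t]) ↦ [J_x, ũ(a,t)·KN]` and `ι` (level `K × L₀` into
`A ⊗_E ℂ`) makes the square `extLevelMap ≫ ι = ι' ≫ (e⁻¹ ≫ towerIso⁻¹ ≫ jA ⊗_E ℂ)` commute, then `ι` satisfies the point formula at
level `K × L₀` through `Ψ = AlgPoints.map (e⁻¹ ≫ towerIso⁻¹ ≫ jA ⊗_E ℂ)`: every point `([x, aK], [t])` lifts to `([x, aK_V], [t])`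
(★ Q4 `extLevelMap_summandPointExt`). [cite: Deligne1971TravauxShimura, §5 (5.11.1) p. 159; Prop. 1.15 p. 132]
[cite: Milne2005ShimuraVarieties, Lemma 5.13 p. 57 and (33) p. 58] -/
theorem pointFormulaK_of_comp_eq (Sc : ComplexRecordSystem L H τ T hT K₀) (Φ : CMType M) (F : SymplecticFrame M j H ξ₀ ξ g δ)
    (hJ : ∀ x : Ball, auxComplexStructure F τ Φ T x ∈ C0pm δ) {LV L₀ : C5.OpenCompactSubgroup ↥(torusFinAdelic M)}
    (hL : LV ≤ L₀) {KV K : C5.SmallLevel K₀} (h : KV ≤ K) (Sg : SiegelComplexRecordSystem g δ)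
    (R : SiegelRationalModel g δ Sg) (KN : SiegelLevel δ) {E : IntermediateField ℚ ℂ} {A : SchemeOver ↥E}
    (jA : (Motives.baseChange ℚ ↥E).obj (R.Nm.obj KN) ⟶ A) (ι' : (complexSystemExt M Sc LV).obj KV ⟶ Sg.Mc.obj KN)
    (ι : (complexSystemExt M Sc L₀).obj K ⟶ (Motives.baseChange ↥E ℂ).obj A)
    (hpf : PointFormulaN M Sc Φ F hJ LV KV Sg KN ι')
    (hsq : extLevelMap M Sc hL (homOfLE h) ≫ ι =
      ι' ≫ (R.e.inv.app KN ≫ (towerIso E (R.Nm.obj KN)).inv ≫ (Motives.baseChange ↥E ℂ).map jA)) :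
    PointFormulaK M Sc Φ F hJ L₀ K Sg KN A ι
      (AlgPoints.map (R.e.inv.app KN ≫ (towerIso E (R.Nm.obj KN)).inv ≫ (Motives.baseChange ↥E ℂ).map jA)) := by
  intro p x a t hp
  subst hp
  have e1 : summandPointExt M Sc L₀ K (classOf M L₀ t) x a =
      AlgPoints.map (extLevelMap M Sc hL (homOfLE h)) (summandPointExt M Sc LV KV (classOf M LV t) x a) :=
    (extLevelMap_summandPointExt M Sc hL (homOfLE h) (classOf M LV t) x a).symm
  rw [e1, ← AlgPoints.map_comp_apply, hsq, AlgPoints.map_comp_apply, hpf (classOf M LV t) x a t rfl]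

end PointFormula

end Summit.HodgeConjecture.CorCM.HypDel.ExtReceptacle.QArch

end
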